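import Literature.NumberTheory.EllipticCurves.EisensteinNewformLevelRaisingWashingtonProofs
import Literature.NumberTheory.EllipticCurves.HeckeEisensteinWeightOneUnit
import Literature.NumberTheory.EllipticCurves.EisensteinNewformLevelRaisingOddAssemblyProofs
import Mathlib.NumberTheory.DirichletCharacter.Orthogonality
import HarnessLib

/-!
# Billerey–Menares 2016, Thm. 2.2: the weight-`3` case and the unconditional theorem (proofs)

Topic `Literature/NumberTheory/EllipticCurves`; namespaces
`Literature.NumberTheory.EllipticCurves.ModularForms.WashingtonLift` and
`Literature.NumberTheory.EllipticCurves`.  THEOREMS and auxiliary definitions (`factorC`,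
`prodFormC`); no named fact (D-0026).

The cuspidal congruence `hC` of `BillereyMenares2016_thm22_exists_newform_of_cuspidalCongruence`
in the remaining weight `k = 3` (`cuspidalCongruence_three`), by the same "Wiles trick" as for
`k ≥ 4` (`EisensteinNewformLevelRaisingWashingtonProofs`) with the product

  `H₀ = S_2^{χₜ,χ}/c' · G̃_{χₜ}(·,0)/c₁ ∈ M_3(Γ₁(N M^r))`,  `χₜ = ψε`,

where `ψ` is a primitive second-kind (even) character modulo `M^r`, `ε` an odd character modulo
`M²` (`exists_odd_dirichletCharacter`; `χₜ` is odd and primitive, `isPrimitive_mul_of_conductor_dvd`),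
`S_2^{χₜ,χ}` the weight-`2` two-character combination of `℘`-division values and `G̃_{χₜ}(·,0)`
Hecke's weight-one Eisenstein series (`HeckeEisensteinWeightOne*`, nebentypus `χ̄ₜ`).  Its
constant terms along `SL₂(ℤ)` are `e χ(d_γ) [N ∣ c_γ, M ∤ c_γ]` with
`e = -e₂(χₜ,χ) · (-B_{1,χₜ}/(2τ(χₜ))) · χ̄ₜ(N)`, a `p`-adic unit by Washington's theorem applied
with `n = 2, θ = χε̄` and `n = 1, θ = ε` (`exists_weightThree_data`).  Finally
`cuspidalCongruence` (all `k ≥ 3`) and the **unconditional**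
`BillereyMenares2016_thm22_exists_newform_holds`.

## References

* N. Billerey, R. Menares, *On the modularity of reducible mod `l` Galois representations*, Math.
  Res. Lett. 23 (2016), §2, Thm. 2.2. [BillereyMenares2016]
* L. C. Washington, *The non-`p`-part of the class number in a cyclotomic `ℤ_p`-extension*,
  Invent. Math. 49 (1978), 87–97. [Washington1978]
* W. Sinnott, *On a theorem of L. Washington*, Astérisque 147–148 (1987), 209–224. [Sinnott1987]
* E. Hecke, *Theorie der Eisensteinschen Reihen höherer Stufe…*, Abh. Math. Sem. Hamburg 5
  (1927), §2. [Hecke1927]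
-/

noncomputable section

open scoped MatrixGroups ModularForm Topology NNReal
open CongruenceSubgroup UpperHalfPlane Filter Matrix.SpecialLinearGroup Complex DirichletCharacter
open Literature.NumberTheory.LFunctions

namespace Literature.NumberTheory.EllipticCurves.ModularForms

namespace WashingtonLift

/-! ### Odd characters of `M`-power conductor and primitivity of `ψε` -/

section OddChar

/-- **An odd Dirichlet character modulo `M²` exists** for every prime `M` (characters of the finite
abelian group `(ℤ/M²)ˣ` separate `-1 ≠ 1`). [folklore] -/
theorem exists_odd_dirichletCharacter (M : ℕ) [hM : Fact M.Prime] :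
    ∃ ε : DirichletCharacter ℂ (M ^ 2), ε.Odd := by
  haveI : NeZero (M ^ 2) := ⟨pow_ne_zero _ hM.out.ne_zero⟩
  have h2 : 2 < M ^ 2 := lt_of_lt_of_le (by norm_num) (Nat.pow_le_pow_left hM.out.two_le 2)
  haveI : Fact (2 < M ^ 2) := ⟨h2⟩
  have hne : (-1 : ZMod (M ^ 2)) ≠ 1 := ZMod.neg_one_ne_one
  obtain ⟨ε, hε⟩ := DirichletCharacter.exists_apply_ne_one_of_hasEnoughRootsOfUnity ℂ hne
  refine ⟨ε, ?_⟩
  have hsq : ε (-1) * ε (-1) = 1 := by rw [← map_mul, neg_one_mul, neg_neg, map_one]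
  rcases mul_self_eq_one_iff.mp hsq with h | h
  · exact absurd h hε
  · exact h

/-- **Primitivity of `ψε`**: if `ψ` is primitive modulo `M^r` and the conductor of `ε` divides
`M^s` with `s < r`, then `ψε` is primitive modulo `M^r` (`cond ψ ∣ lcm(cond(ψε), cond ε)`).
[folklore] -/
theorem isPrimitive_mul_of_conductor_dvd {M r s : ℕ} [hM : Fact M.Prime] (hsr : s < r)
    (ψ ε : DirichletCharacter ℂ (M ^ r)) (hψ : ψ.IsPrimitive) (hε : ε.conductor ∣ M ^ s) :
    (ψ * ε).IsPrimitive := by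
  haveI : NeZero (M ^ r) := ⟨pow_ne_zero _ hM.out.ne_zero⟩
  have h1 : ψ.conductor ∣ Nat.lcm (ψ * ε).conductor ε⁻¹.conductor := by
    have := conductor_mul_dvd_lcm_conductor (ψ * ε) ε⁻¹
    rwa [mul_inv_cancel_right] at this
  rw [conductor_inv, hψ] at h1
  obtain ⟨i, hi, hci⟩ := (Nat.dvd_prime_pow hM.out).mp (conductor_dvd_level (ψ * ε))
  obtain ⟨j, hj, hcj⟩ := (Nat.dvd_prime_pow hM.out).mp hε
  rw [hci, hcj] at h1
  have h2 : Nat.lcm (M ^ i) (M ^ j) ∣ M ^ max i j :=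
    Nat.lcm_dvd (pow_dvd_pow M (le_max_left i j)) (pow_dvd_pow M (le_max_right i j))
  have h3 : r ≤ max i j := (Nat.pow_dvd_pow_iff_le_right hM.out.one_lt).mp (h1.trans h2)
  have hir : i = r := by
    rcases Nat.lt_or_ge i r with h | h
    · exfalso
      have : max i j < r := max_lt h (by omega)
      omega
    · omega
  rw [DirichletCharacter.IsPrimitive, hci, hir]

end OddChar

/-! ### The weight-one factor `G̃_{χₜ}(·,0)/c₁` and the product `H₀` for `k = 3` -/

section ProdC

variable {N : ℕ} [NeZero N] (χ : DirichletCharacter ℂ N) {M : ℕ} [hM : Fact M.Prime] {r : ℕ}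
  (χt : DirichletCharacter ℂ (M ^ r))

/-- The normalised weight-one factor `G̃_{χₜ}(·,0)/c₁` on `Γ₁(M^r)`. [cite: Hecke1927, §2] -/
def factorC (hprim : χt.IsPrimitive) (hodd : χt.Odd) : ModularForm (Gamma1 (M ^ r)) 1 :=
  (heckeOneConst χt)⁻¹ • heckeOneMF χt hprim hodd

/-- The function of `factorC`. [folklore] -/
theorem coe_factorC (hprim : χt.IsPrimitive) (hodd : χt.Odd) :
    (⇑(factorC χt hprim hodd) : ℍ → ℂ) = (heckeOneConst χt)⁻¹ • heckeOne χt := rfl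

/-- Nebentypus `χ̄ₜ` of the weight-one factor on `Γ₀(M^r)`. [cite: Miyake2006, Thm. 7.2.13] -/
theorem factorC_slash_of_mem_gamma0 (hprim : χt.IsPrimitive) (hodd : χt.Odd) {γ : SL(2, ℤ)}
    (hγ : γ ∈ Gamma0 (M ^ r)) :
    (⇑(factorC χt hprim hodd) : ℍ → ℂ) ∣[(1 : ℤ)] γ =
      χt⁻¹ ((γ 1 1 : ℤ) : ZMod (M ^ r)) • (⇑(factorC χt hprim hodd) : ℍ → ℂ) := by
  rw [coe_factorC, ModularForm.SL_smul_slash, heckeOne_slash_of_mem_gamma0 χt hodd hγ, smul_comm]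

/-- The limits of the weight-one factor at all cusps. [cite: Hecke1927, §2] -/
theorem tendsto_factorC_slash_atImInfty (hprim : χt.IsPrimitive) (hodd : χt.Odd) (A : SL(2, ℤ)) :
    Tendsto ((⇑(factorC χt hprim hodd) : ℍ → ℂ) ∣[(1 : ℤ)] A) atImInfty
      (𝓝 ((heckeOneConst χt)⁻¹ * heckeOneCusp χt A)) := by
  rw [coe_factorC, ModularForm.SL_smul_slash]
  exact (tendsto_heckeOne_slash_atImInfty χt hodd A).const_mul _

/-- `p`-integrality of the coefficients of the weight-one factor. [cite: Miyake2006, Thm. 7.2.13] -/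
theorem valuation_qExpansion_coeff_factorC_le_one {p : ℕ} [Fact p.Prime] (ι : PadicAlgCl p ≃+* ℂ)
    (hprim : χt.IsPrimitive) (hodd : χt.Odd) (hpM : ¬ p ∣ M ^ r) (hp2 : p ≠ 2) (n : ℕ) :
    Valued.v (ι.symm ((qExpansion 1 (⇑(factorC χt hprim hodd) : ℍ → ℂ)).coeff n)) ≤ 1 := by
  rw [factorC, ModularForm.IsGLPos.coe_smul,
    ModularForm.qExpansion_smul one_pos (HeckeTGamma1.one_mem_strictPeriods_Gamma1 _) _
      (heckeOneMF χt hprim hodd),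
    PowerSeries.coeff_smul, smul_eq_mul, qExpansion_coeff_heckeOneMF]
  exact valuation_inv_heckeOneConst_mul_coeff_le_one χt ι hprim hodd hpM hp2 n

/-- **The product form `H₀ = S_2^{χₜ,χ}/c' · G̃_{χₜ}(·,0)/c₁ ∈ M_3(Γ₁(N M^r))`.**
[cite: Wiles1980, §2 (products of Eisenstein series)] -/
def prodFormC (hprim : χt.IsPrimitive) (hodd : χt.Odd) : ModularForm (Gamma1 (N * M ^ r)) (3 : ℕ) :=
  ModularForm.mcast (by norm_num)
    ((restrictGamma1 (by rw [mul_comm]) (factorA χ χt)).mul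
      (restrictGamma1 (dvd_mul_left _ _) (factorC χt hprim hodd)))

/-- `H₀` as a function. [folklore] -/
theorem coe_prodFormC (hprim : χt.IsPrimitive) (hodd : χt.Odd) :
    (⇑(prodFormC χ χt hprim hodd) : ℍ → ℂ) = (⇑(factorA χ χt) : ℍ → ℂ) * ⇑(factorC χt hprim hodd) := by
  rw [prodFormC, ModularForm.coe_mcast, ModularForm.coe_mul, coe_restrictGamma1, coe_restrictGamma1]

/-- **`H₀` is `Γ₀(N M^r)`-equivariant with character `χ`**: `(χₜχ)·χ̄ₜ = χ`.
[cite: DiamondShurman2005, Thm. 4.6.2] [cite: Miyake2006, Thm. 7.2.13] -/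
theorem prodFormC_slash_of_mem_gamma0 (hprim : χt.IsPrimitive) (hodd : χt.Odd) {γ : SL(2, ℤ)}
    (hγ : γ ∈ Gamma0 (N * M ^ r)) :
    (⇑(prodFormC χ χt hprim hodd) : ℍ → ℂ) ∣[((3 : ℕ) : ℤ)] γ =
      χ ((γ 1 1 : ℤ) : ZMod N) • ⇑(prodFormC χ χt hprim hodd) := by
  have hγA : γ ∈ Gamma0 (M ^ r * N) := by rwa [mul_comm] at hγ
  have hγr : γ ∈ Gamma0 (M ^ r) := gamma0_le_of_dvd (dvd_mul_left (M ^ r) N) hγ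
  rw [coe_prodFormC, mul_slash_SL2_of_add_eq (k₁ := 2) (k₂ := 1) (by norm_num) γ,
    factorA_slash_of_mem_gamma0 χ χt hγA, factorC_slash_of_mem_gamma0 χt hprim hodd hγr,
    smul_mul_smul_comm]
  congr 1
  have hd : IsUnit ((γ 1 1 : ℤ) : ZMod (M ^ r)) := isUnit_apply11_of_mem_gamma0 hγr
  have hne : χt ((γ 1 1 : ℤ) : ZMod (M ^ r)) ≠ 0 := (hd.map χt).ne_zero
  rw [MulChar.inv_apply_eq_inv', mul_comm (χt _) (χ _), mul_assoc, mul_inv_cancel₀ hne, mul_one]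

/-- **Constant terms of `H₀` along `SL₂(ℤ)`** (`k = 3`):
`-e₂(χₜ,χ) · heckeOneUnit(χₜ) · χ̄ₜ(N) · χ(d_γ) [N ∣ c_γ, M ∤ c_γ]`.
[cite: DiamondShurman2005, §4.6] [cite: Hecke1927, §2] -/
theorem tendsto_prodFormC_slash_atImInfty (hr : 1 ≤ r) (hMN : M.Coprime N) (hprim : χt.IsPrimitive)
    (hodd : χt.Odd) (hχ : χ.IsPrimitive) (hχpar : χ (-1) = -1) (γ : SL(2, ℤ)) :
    Tendsto ((⇑(prodFormC χ χt hprim hodd) : ℍ → ℂ) ∣[((3 : ℕ) : ℤ)] γ) atImInfty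
      (𝓝 (if (N : ℤ) ∣ γ 1 0 ∧ ¬ (M : ℤ) ∣ γ 1 0 then
        (-(twoCharTwoUnit χt χ * heckeOneUnit χt * χt⁻¹ (N : ZMod (M ^ r)))) *
          χ ((γ 1 1 : ℤ) : ZMod N) else 0)) := by
  have hodd' : χt (-1) = -1 := hodd
  have hpar : χt (-1) * χ (-1) = 1 := by rw [hodd', hχpar]; norm_num
  have hne : χt ≠ 1 := ne_one_of_isPrimitive_pow χt hr hprim
  have hA := tendsto_factorA_slash_atImInfty χ χt γ
  have hB := tendsto_factorC_slash_atImInfty χt hprim hodd γ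
  rw [coe_prodFormC, mul_slash_SL2_of_add_eq (k₁ := 2) (k₂ := 1) (by norm_num) γ]
  have hAB : Tendsto ((⇑(factorA χ χt) : ℍ → ℂ) ∣[(2 : ℤ)] γ *
      (⇑(factorC χt hprim hodd) : ℍ → ℂ) ∣[(1 : ℤ)] γ) atImInfty
      (𝓝 ((twoCharTwoConst (M ^ r) χ)⁻¹ * twoCharTwoCusp χt χ γ *
        ((heckeOneConst χt)⁻¹ * heckeOneCusp χt γ))) := hA.mul hB
  convert hAB using 2
  by_cases hNc : (N : ℤ) ∣ γ 1 0
  · obtain ⟨c', hc'⟩ := hNc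
    rw [inv_twoCharTwoConst_mul_twoCharTwoCusp_of_eq_mul χt χ hprim hne hχ (Nat.Coprime.pow_left r hMN)
      hpar c' hc']
    by_cases hMc : (M : ℤ) ∣ γ 1 0
    · rw [if_neg fun h ↦ h.2 hMc]
      have hMc' : (M : ℤ) ∣ c' := prime_dvd_of_dvd_mul_left hMN (hc' ▸ hMc)
      rw [χt.map_nonunit (not_isUnit_of_prime_dvd hr (dvd_neg.mpr hMc'))]
      simp
    · rw [if_pos ⟨⟨c', hc'⟩, hMc⟩]
      have hcu : IsUnit ((γ 1 0 : ℤ) : ZMod (M ^ r)) := isUnit_of_not_prime_dvd hMc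
      rw [inv_heckeOneConst_mul_heckeOneCusp_of_isUnit χt hprim hodd hcu]
      have hMc' : ¬ (M : ℤ) ∣ c' := fun h ↦ hMc (hc' ▸ dvd_mul_of_dvd_right h _)
      have hψc := inv_apply_mul_of_not_dvd (N := N) χt hMc'
      have hneg : χt ((-c' : ℤ) : ZMod (M ^ r)) = -χt ((c' : ℤ) : ZMod (M ^ r)) := by
        rw [Int.cast_neg, ← neg_one_mul, map_mul, hodd', neg_one_mul]
      rw [hneg, hc']
      linear_combination (twoCharTwoUnit χt χ * heckeOneUnit χt * χ ((γ 1 1 : ℤ) : ZMod N)) * hψc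
  · rw [if_neg fun h ↦ hNc h.1, twoCharTwoCusp_of_not_dvd χt χ hne hNc, mul_zero, zero_mul]

/-- **`p`-integrality of the `q`-expansion of `H₀`** (`k = 3`). [cite: DiamondShurman2005, §4.6] -/
theorem valuation_qExpansion_coeff_prodFormC_le_one {p : ℕ} [Fact p.Prime] (ι : PadicAlgCl p ≃+* ℂ)
    (hr : 1 ≤ r) (hprim : χt.IsPrimitive) (hodd : χt.Odd) (hχ : χ.IsPrimitive) (hχpar : χ (-1) = -1)
    (hpM : ¬ p ∣ M) (hp2 : p ≠ 2) (n : ℕ) :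
    Valued.v (ι.symm ((qExpansion 1 ⇑(prodFormC χ χt hprim hodd)).coeff n)) ≤ 1 := by
  set A : ModularForm (Gamma1 (N * M ^ r)) 2 := restrictGamma1 (by rw [mul_comm]) (factorA χ χt)
    with hAdef
  set B : ModularForm (Gamma1 (N * M ^ r)) 1 :=
    restrictGamma1 (dvd_mul_left _ _) (factorC χt hprim hodd) with hBdef
  have hcoe : (⇑(prodFormC χ χt hprim hodd) : ℍ → ℂ) = ⇑A * ⇑B := coe_prodFormC χ χt hprim hodd
  have hq : qExpansion 1 (⇑(prodFormC χ χt hprim hodd) : ℍ → ℂ) = qExpansion 1 ⇑A * qExpansion 1 ⇑B := by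
    rw [hcoe]
    exact ModularForm.qExpansion_mul_coe one_pos (HeckeTGamma1.one_mem_strictPeriods_Gamma1 _) A B
  rw [hq, PowerSeries.coeff_mul, map_sum]
  refine Valuation.map_sum_le _ fun ij _ ↦ ?_
  rw [map_mul, Valuation.map_mul]
  have hodd' : χt (-1) = -1 := hodd
  have hpar : χt (-1) * χ (-1) = 1 := by rw [hodd', hχpar]; norm_num
  have hpMr : ¬ p ∣ M ^ r := fun h ↦ hpM (Nat.Prime.dvd_of_dvd_pow Fact.out h)
  refine mul_le_one' ?_ ?_
  · rw [hAdef, coe_restrictGamma1]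
    exact valuation_qExpansion_coeff_factorA_le_one χ χt ι hr hprim hχ hpar ij.1
  · rw [hBdef, coe_restrictGamma1]
    exact valuation_qExpansion_coeff_factorC_le_one χt ι hprim hodd hpMr hp2 ij.2

end ProdC

/-! ### The cuspidal congruence for `k = 3`, and for all `k ≥ 3` -/

section Final

variable {p : ℕ} [Fact p.Prime]

/-- Same prime divisors: `M^r N` vs `N M² M^r`, and `M^r` vs `M² M^r` (`r ≥ 1`). [folklore] -/
theorem prime_dvd_iff_aux₂ {N M r ℓ : ℕ} (hM : M.Prime) (hr : 1 ≤ r) (hℓ : ℓ.Prime) :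
    (ℓ ∣ M ^ r * N ↔ ℓ ∣ N * M ^ 2 * M ^ r) ∧ (ℓ ∣ M ^ r ↔ ℓ ∣ M ^ 2 * M ^ r) := by
  have hMr : ℓ ∣ M ^ r ↔ ℓ = M := by
    constructor
    · intro h; exact (Nat.prime_dvd_prime_iff_eq hℓ hM).mp (hℓ.dvd_of_dvd_pow h)
    · rintro rfl; exact dvd_pow_self _ (by omega)
  have hM2 : ℓ ∣ M ^ 2 ↔ ℓ = M := by
    constructor
    · intro h; exact (Nat.prime_dvd_prime_iff_eq hℓ hM).mp (hℓ.dvd_of_dvd_pow h)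
    · rintro rfl; exact dvd_pow_self _ (by omega)
  simp only [Nat.Prime.dvd_mul hℓ, hMr, hM2]
  tauto

open Sinnott1987 in
/-- **The data for `k = 3`**: for `χ` odd modulo `N`, `M ≠ p` prime, `p ≠ 2`, there are `r ≥ 1` and
an odd primitive character `χₜ = ψε` modulo `M^r` (`ψ` of the second kind, `ε` odd modulo `M²`)
with `B_{2,(χₜχ̄)⁻¹}/2` and `B_{1,χₜ}` `p`-adic units (Washington's theorem twice).
[cite: Washington1978, Theorem] [cite: Sinnott1987, §4.5] -/
theorem exists_weightThree_data (ι : PadicAlgCl p ≃+* ℂ) {N : ℕ} [NeZero N]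
    (χ : DirichletCharacter ℂ N) {M : ℕ} [hM : Fact M.Prime] (hMp : M ≠ p) (hp2 : p ≠ 2)
    (hχpar : χ (-1) = -1) :
    ∃ r : ℕ, 1 ≤ r ∧ ∃ χt : DirichletCharacter ℂ (M ^ r), χt.IsPrimitive ∧ χt.Odd ∧
      Valued.v (ι.symm (generalizedBernoulli 2
        (changeLevel (dvd_mul_right (M ^ r) N) χt * changeLevel (dvd_mul_left N (M ^ r)) χ⁻¹)⁻¹ / 2)) = 1 ∧
      Valued.v (ι.symm (generalizedBernoulli 1 χt)) = 1 := by
  have hM' := hM.out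
  haveI : NeZero M := ⟨hM'.ne_zero⟩
  have hp : p.Prime := Fact.out
  obtain ⟨ε, hεodd⟩ := exists_odd_dirichletCharacter M
  have hε1 : ε (-1) = -1 := hεodd
  -- ### the valuation `v₀ = v_p ∘ ι⁻¹` on `ℂ`
  set v₀ : Valuation ℂ ℝ≥0 := (Valued.v (R := PadicAlgCl p)).comap ι.symm.toRingHom with hv₀def
  have hv₀ : ∀ x, v₀ x = Valued.v (ι.symm x) := fun x ↦ rfl
  have hvp : v₀ (p : ℂ) < 1 := by
    rw [hv₀, map_natCast, PadicAlgCl.valuation_p, one_div]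
    exact inv_lt_one_of_one_lt₀ (by exact_mod_cast hp.one_lt)
  have hroots : ∀ m : ℕ, 0 < m → ∃ ζ : ℂ, IsPrimitiveRoot ζ m := fun m hm ↦
    ⟨_, Complex.isPrimitiveRoot_exp m hm.ne'⟩
  -- ### Washington's theorem, twice
  set θA := changeLevel (dvd_mul_right N (M ^ 2)) χ * changeLevel (dvd_mul_left (M ^ 2) N) ε⁻¹ with hθA
  have hparA : θA (-1) = (-1) ^ 2 := by
    rw [hθA, changeLevel_mul_changeLevel_inv_apply_neg_one, hχpar, hε1]; norm_num
  obtain ⟨rA, hrA⟩ := washington_sinnott_valuation_eq_one v₀ hvp hMp hp2 hroots (f := N * M ^ 2)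
    (Dvd.dvd.mul_left (dvd_pow_self M two_ne_zero) N) θA (n := 2) (by norm_num) hparA
  have hparC : ε (-1) = (-1) ^ 1 := by rw [hε1, pow_one]
  obtain ⟨rC, hrC⟩ := washington_sinnott_valuation_eq_one v₀ hvp hMp hp2 hroots (f := M ^ 2)
    (dvd_pow_self M two_ne_zero) ε (n := 1) le_rfl hparC
  -- ### the conductor exponent `r`, the second-kind character `ψ`, and `χₜ = ψ ε`
  set r : ℕ := max (max rA rC) (max (depth M + 1) 3) with hrdef
  have hrd : depth M < r := by omega
  have hr3 : 3 ≤ r := by omega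
  have hr1 : 1 ≤ r := by omega
  obtain ⟨ψ, hψprim, hψV, hψker⟩ := exists_secondKind_complex (M := M) (m := r) hrd
  have hψ1 : ψ (-1) = 1 := by simpa using hψV (-1) isTors_neg_one
  have hψinvV : ∀ u : (ZMod (M ^ r))ˣ, IsTors u → ψ⁻¹ u = 1 := fun u hu ↦ by
    rw [MulChar.inv_apply_eq_inv', hψV u hu, inv_one]
  have hψinvker : ∀ u : (ZMod (M ^ r))ˣ, ψ⁻¹ u = 1 → IsTors u := fun u hu ↦ by
    rw [MulChar.inv_apply_eq_inv', inv_eq_one] at hu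
    exact hψker u hu
  have h2r : M ^ 2 ∣ M ^ r := pow_dvd_pow M (by omega)
  set χt : DirichletCharacter ℂ (M ^ r) := ψ * changeLevel h2r ε with hχt
  have hεlift : changeLevel h2r ε (-1) = ε (-1) := by
    have hu : ((-1 : (ZMod (M ^ r))ˣ) : ZMod (M ^ r)) = -1 := by simp
    rw [← hu, changeLevel_eq_cast_of_dvd ε h2r]
    simp only [Units.val_neg, Units.val_one]
    rw [ZMod.cast_neg h2r, ZMod.cast_one h2r]
  have hχtodd : χt.Odd := by
    change χt (-1) = -1
    rw [hχt, MulChar.mul_apply, hψ1, one_mul, hεlift, hε1]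
  have hχtprim : χt.IsPrimitive := by
    refine isPrimitive_mul_of_conductor_dvd (s := 2) (by omega) ψ _ hψprim ?_
    rw [conductor_changeLevel]
    exact conductor_dvd_level ε
  have hpr : ∀ ℓ : ℕ, ℓ.Prime → ℓ ∣ M ^ r → ℓ ∣ M ^ 2 := fun ℓ hℓ h ↦ by
    rw [(Nat.prime_dvd_prime_iff_eq hℓ hM').mp (hℓ.dvd_of_dvd_pow h)]
    exact dvd_pow_self M two_ne_zero
  have hχtval : ∀ a : ℕ, χt a = ψ a * ε a := fun a ↦ by
    rw [hχt, MulChar.mul_apply, changeLevel_apply_natCast_of_primes h2r hpr ε a]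
  -- ### the two Bernoulli units
  have hWA := hrA r (by omega) ψ hψprim hψV hψker
  have hWC := hrC r (by omega) ψ⁻¹ (Literature.NumberTheory.LFunctions.isPrimitive_inv ψ hψprim)
    hψinvV hψinvker
  rw [hv₀] at hWA hWC
  haveI : NeZero (N * M ^ 2 * M ^ r) := inferInstance
  refine ⟨r, hr1, χt, hχtprim, hχtodd, ?_, ?_⟩
  · rw [← hWA]
    congr 3
    refine generalizedBernoulli_eq_of_apply_natCast_eq _ _
      (fun ℓ hℓ ↦ (prime_dvd_iff_aux₂ (N := N) hM' hr1 hℓ).1) (fun a ↦ ?_) _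
    rw [MulChar.inv_apply_eq_inv', changeLevel_mul_changeLevel_inv_apply_natCast χt χ a,
      changeLevel_mul_changeLevel_inv_apply_natCast θA ψ a, hθA,
      changeLevel_mul_changeLevel_inv_apply_natCast χ ε a, hχtval a, MulChar.inv_apply_eq_inv' χ,
      MulChar.inv_apply_eq_inv' ψ, MulChar.inv_apply_eq_inv' ε, mul_inv, mul_inv, inv_inv]
    ring
  · have hWC' : Valued.v (ι.symm (generalizedBernoulli 1
        (changeLevel (dvd_mul_right (M ^ 2) (M ^ r)) ε *
          changeLevel (dvd_mul_left (M ^ r) (M ^ 2)) ψ⁻¹⁻¹))) = 1 := by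
      simpa using hWC
    rw [← hWC']
    congr 2
    refine generalizedBernoulli_eq_of_apply_natCast_eq _ _
      (fun ℓ hℓ ↦ (prime_dvd_iff_aux₂ (N := N) hM' hr1 hℓ).2) (fun a ↦ ?_) _
    rw [changeLevel_mul_changeLevel_inv_apply_natCast ε ψ⁻¹ a, inv_inv, hχtval a, mul_comm]

/-- **The cuspidal congruence `hC` for `k = 3`, unconditionally.**
[cite: BillereyMenares2016, §2, proof of Thm. 2.2 (p. 7)] [cite: Washington1978, Theorem]
[cite: Hecke1927, §2] -/
theorem cuspidalCongruence_three (ι : PadicAlgCl p ≃+* ℂ) {N : ℕ} [NeZero N]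
    (χ : DirichletCharacter ℂ N) (hk : 3 ≤ 3) (M : ℕ) [NeZero M] (hp5 : 5 ≤ p)
    (hχ : χ.IsPrimitive) (hpar : χ (-1) = (-1) ^ 3) (hpN : ¬ p ∣ N) (hM : M.Prime) (hMN : ¬ M ∣ N)
    (hMp : M ≠ p)
    (hcusp : ∀ γ : SL(2, ℤ), ∃ c : ℂ,
      Tendsto ((⇑(eisensteinLevelRaised N 3 χ M hk) : ℍ → ℂ) ∣[((3 : ℕ) : ℤ)] γ) atImInfty (𝓝 c) ∧
        Valued.v (ι.symm c) < 1) :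
    ∃ f₀ : CuspForm (Gamma1 (N * M)) (3 : ℕ),
      f₀ ∈ nebentypusSubspace (N * M) (3 : ℕ) (DirichletCharacter.changeLevel (dvd_mul_right N M) χ) ∧
      ∀ n, Valued.v (ι.symm (cuspCoeff f₀ n -
        (qExpansion 1 ⇑(eisensteinLevelRaised N 3 χ M hk)).coeff n)) < 1 := by
  haveI hMf : Fact M.Prime := ⟨hM⟩
  have hMN' : M.Coprime N := (Nat.Prime.coprime_iff_not_dvd hM).2 hMN
  have hp2 : p ≠ 2 := by omega
  have hpM : ¬ p ∣ M := fun h ↦ hMp ((Nat.prime_dvd_prime_iff_eq Fact.out hM).mp h).symm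
  have hχ1 : χ (-1) = -1 := by rw [hpar]; norm_num
  obtain ⟨r, hr1, χt, hprim, hodd, hBA, hBC⟩ := exists_weightThree_data ι χ hMp hp2 hχ1
  have hpMr : ¬ p ∣ M ^ r := fun h ↦ hpM (Nat.Prime.dvd_of_dvd_pow Fact.out h)
  have hodd' : χt (-1) = -1 := hodd
  have hpar' : χt (-1) * χ (-1) = 1 := by rw [hodd', hχ1]; norm_num
  have he₂ : Valued.v (ι.symm (twoCharTwoUnit χt χ)) = 1 :=
    valuation_twoCharTwoUnit_eq_one χt χ ι hprim hχ (Nat.Coprime.pow_left r hMN') hpMr hpN hp2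
      (by simpa using hBA)
  have hU : Valued.v (ι.symm (heckeOneUnit χt)) = 1 :=
    valuation_heckeOneUnit_eq_one χt ι hprim hpMr hp2 hBC
  have he : Valued.v (ι.symm (-(twoCharTwoUnit χt χ * heckeOneUnit χt * χt⁻¹ (N : ZMod (M ^ r))))) = 1 := by
    rw [map_neg, Valuation.map_neg]
    simp only [map_mul, he₂, hU, valuation_inv_apply_level_eq_one ι hMN' χt, one_mul]
  obtain ⟨H, hH1, hH2, e, he', hH3⟩ := WashingtonLift.descend ι χ hMN' hMp ((3 : ℕ) : ℤ) r hr1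
    (prodFormC χ χt hprim hodd)
    (fun γ hγ ↦ prodFormC_slash_of_mem_gamma0 χ χt hprim hodd hγ)
    (valuation_qExpansion_coeff_prodFormC_le_one χ χt ι hr1 hprim hodd hχ hχ1 hpM hp2)
    ⟨_, he, tendsto_prodFormC_slash_atImInfty χ χt hr1 hMN' hprim hodd hχ hχ1⟩
  exact CuspFormLift.exists_cuspForm_nebentypus_congr_of_integralForm ι χ 3 hk M hM hMN hcusp H
    hH1 hH2 e he' hH3

/-- **The cuspidal congruence `hC` for all `k ≥ 3`, unconditionally** (no Katz/Carayol input).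
[cite: BillereyMenares2016, §2, proof of Thm. 2.2] -/
theorem cuspidalCongruence (ι : PadicAlgCl p ≃+* ℂ) {N : ℕ} [NeZero N]
    (χ : DirichletCharacter ℂ N) (k : ℕ) (hk : 3 ≤ k) (M : ℕ) [NeZero M] (hp5 : 5 ≤ p)
    (hχ : χ.IsPrimitive) (hpar : χ (-1) = (-1) ^ k) (hpN : ¬ p ∣ N) (hM : M.Prime) (hMN : ¬ M ∣ N)
    (hMp : M ≠ p)
    (hcusp : ∀ γ : SL(2, ℤ), ∃ c : ℂ,
      Tendsto ((⇑(eisensteinLevelRaised N k χ M hk) : ℍ → ℂ) ∣[(k : ℤ)] γ) atImInfty (𝓝 c) ∧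
        Valued.v (ι.symm c) < 1) :
    ∃ f₀ : CuspForm (Gamma1 (N * M)) k,
      f₀ ∈ nebentypusSubspace (N * M) k (DirichletCharacter.changeLevel (dvd_mul_right N M) χ) ∧
      ∀ n, Valued.v (ι.symm (cuspCoeff f₀ n -
        (qExpansion 1 ⇑(eisensteinLevelRaised N k χ M hk)).coeff n)) < 1 := by
  rcases Nat.lt_or_ge k 4 with h | h
  · obtain rfl : k = 3 := by omega
    exact cuspidalCongruence_three ι χ hk M hp5 hχ hpar hpN hM hMN hMp hcusp
  · exact cuspidalCongruence_of_four_le ι χ k hk M hp5 hχ hpar hpN hM hMN hMp h hcusp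

end Final

end WashingtonLift

end Literature.NumberTheory.EllipticCurves.ModularForms

/-! ### The unconditional theorem -/

namespace Literature.NumberTheory.EllipticCurves

open Literature.NumberTheory.EllipticCurves.ModularForms

/-- **Billerey–Menares 2016, Thm. 2.2 (existence of the congruent newform), unconditionally.**
For a prime `p ≥ 5`, an odd character `θ : G_ℚ → 𝔽̄_pˣ` unramified at `p` of prime-to-`p` order,
an admissible weight `k`, and a prime `M ∤ p N_θ` at which `p` is `(θ, p, k)`-admissible, there is a
newform of weight `k`, level `N_θ M` and (Teichmüller-lifted) nebentypus `θ` whose mod-`p`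
representation is `1 ⊕ θ χ_p^{k-1}`.  Proof: `BillereyMenares2016_thm22_exists_newform_of_cuspidalCongruence`
(Deligne–Serre lifting, the Eisenstein/cusp-form dictionary) applied to the cuspidal congruence
`WashingtonLift.cuspidalCongruence`, obtained from products of two-character Eisenstein series of
`M`-power conductor with unit constant terms (Washington's theorem, Sinnott's proof) and `U_M`-level
lowering — replacing the geometric (Katz) argument of the paper.
[cite: BillereyMenares2016, §2, Thm. 2.2] [cite: Washington1978, Theorem] [cite: Sinnott1987, §4.5] -/
theorem BillereyMenares2016_thm22_exists_newform_holds : BillereyMenares2016_thm22_exists_newform :=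
  BillereyMenares2016_thm22_exists_newform_of_cuspidalCongruence
    fun _ _ ι _ _ χ k hk M _ hp5 hχ hpar hpN hM hMN hMp _ _ _ hcusp ↦
      WashingtonLift.cuspidalCongruence ι χ k hk M hp5 hχ hpar hpN hM hMN hMp hcusp

end Literature.NumberTheory.EllipticCurves
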